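import Literature.Geometry.Kaehler.ComplexTorusDivisorBorderedHessianRank
import Literature.Geometry.Kaehler.SiegelTorusThetaNullRankModular
import Literature.LinearAlgebra.Matrix.ABVersusBAJordanStructure
import HarnessLib

/-!
# On the singular locus the rank of the bordered Hessian is the rank of the tangent cone:
# `Σ_r(D) ∩ Sing D = {rk TC_x(D) ≤ r}`, `Σ₁(D) ⊆ Sing D`, `Σ₀(D) = {mult_x(D) ≥ 3}`, planar smooth points
# have rank exactly `2`, and GSM's `θ_{[k,l]}^h` is `Σ_h` at the even two-torsion point

[tag: lange-cav-complex-tori] [linked: HodgeConjecture (lit-hodgefound SKELETON §A2, row A2-211)]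

Layer `Literature/Geometry/Kaehler`, namespaces `Literature.Geometry.Kaehler.SCV` (§1–§2) and
`Literature.Geometry.Kaehler.ComplexTorus` (§3–§4); lane `lit-hodgefound` (Track 2 foundations library),
skeleton seat `lit-hodgefound-skel-2` (generation 43), plan row A2-211 (sequel of A2-207
`ComplexTorusDivisorBorderedHessianRank`, which computed the rank of the bordered Hessian
`B_ϑ(v) = ( D²ϑ(v) dϑ(v) ; ᵗdϑ(v) 0 )` on the SMOOTH part: `rank B = rk S_x + 2 ≥ 2`, and proved the
Thom–Boardman loci `Σ_r(D) = π{ϑ = 0, rank B ≤ r}` analytic). Here the SINGULAR part: at a point with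
`dϑ(v) = 0` the border vanishes and `rank B_ϑ(v) = rk D²ϑ(v) = rk TC_x(D)` (the rank of the tangent cone
quadric, A2-185/A2-198 `hessianRank`); so `Σ_r(D)` is the DISJOINT union of the smooth stratum
`{x ∈ D_s : rk S_x ≤ r − 2}` and the singular stratum `{x ∈ Sing D : rk TC_x(D) ≤ r}` (the corank
stratification of Ciliberto–van der Geer); in particular `Σ₁(D) ⊆ Sing D` (tangent cones of rank `≤ 1`)
and `Σ₀(D) = {x : mult_x(D) ≥ 3}`; a smooth point with `D²ϑ(v) = 0` (a planar point — e.g. an odd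
two-torsion point of a symmetric theta divisor, A2-202) has `rank B = 2` exactly; and for the Riemann
theta function with even half-integer characteristic `[k/2; l/2]`, whose gradient at `z = 0` vanishes,
GSM's component `θ_{[k,l]}^h = {ϑ[k/2;l/2](0,Z) = 0, rk (∂ᵢ∂ⱼϑ)(0) ≤ h}` of `θ_null^h` is exactly the
condition `rank B_{ϑ[k/2;l/2](·,Z)}(0) ≤ h` — the bordered condition "`rk ( θ_{ij} θ_i ; θ_j 0 ) ≤ h`" of
Grushevsky–Salvati Manni 2007. Theorems only; no definition, no named fact.

Sources, VERBATIM. S. Grushevsky, R. Salvati Manni, *Jacobians with a vanishing theta-null in genus 4*,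
Israel J. Math. 164 (2008) [held `paper:arxiv-math_0605160` p0004]: "Definition 6. […] For
`h = 0, …, g` we let `θ_null^h = {τ ∈ ℍ_g : ∃[ε,δ] even, θ[ε;δ](τ) = 0; rk ∂²θ[ε;δ](τ,z)/∂zᵢ∂zⱼ|_{z=0}
≤ h}`". S. Grushevsky, R. Salvati Manni, IMRN 2007 [held `paper:arxiv-math_0701423` p0007], proof of
Thm. 3: "`θ_null^h ∩ ∂𝒜_g` restricted to the above component is described by the following analytic
conditions `θ(τ′, z/2) = 0`, `rk ( ∂²θ/∂zᵢ∂zⱼ ∂θ/∂zᵢ ; ∂θ/∂zⱼ 0 )(τ′, z/2) ≤ h`"; Lemma 2: "`dF`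
ramifies at `x ∈ X` if and only if the matrix `( ∂ᵢ∂ⱼF ∂ᵢF ; ∂ⱼF 0 )` does not have maximal rank";
p0010: "if `z = (τε+δ)/2 ∈ X_τ[2]` is an odd point, then `0 = θ(τ,z) = ∂ᵢ∂ⱼθ(τ,z)` automatically".
C. Ciliberto, G. van der Geer, *Andreotti–Mayer loci and the Schottky problem*, Doc. Math. 13 (2008)
[held], §2 (chunk p0005): the loci `S_{g,k}` of `Sing(Θ)` by the corank of the quadric tangent cone,
Def. 9 (minors). D. Eisenbud, J. Harris, *3264 and All That* (2016), Thm. 7.11 (chunk p0291): "The set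
of points `X_i ⊂ X` where the rank of the quadratic form `S(f)_p` is at most `i`". H. Lange, *Abelian
Varieties over the Complex Numbers* (2023), §2.3.4 (p. 105 L20: "`mult_{v̄}(D)` is just the subdegree
of the Taylor expansion of `ϑ`").

Dictionary. `B_f(v)[b] = Matrix.fromBlocks (D²f(v)(bᵢ,bⱼ)) (df(v)bᵢ) (df(v)bⱼ) 0` (A2-200), `H_f(v)[b] =
(D²f(v)(bᵢ,bⱼ))`, `hessianRank f v = rk D²f(v)` (A2-185), `f_T(w) = f(v + w)` on `T = Ker df(v)` (A2-197);
"`Sing`" = `df(v) = 0` on `f = 0` (`ord_v f ≥ 2`), "`mult ≥ 3`" = `ord_v f ≥ 3`.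

## Contents

* §1 (linear algebra) `rank_fromBlocks_border_zero` (`rank ( H 0 ; 0 0 ) = rank H`, from the tree's
  `rank_fromBlocks_zero₁₂_zero₂₁`).
* §2 (SCV, `E` finite-dimensional) `bordered_eq_fromBlocks_of_fderiv_eq_zero`,
  **`rank_borderedHessian_eq_rank_hessian_of_fderiv_eq_zero`** (any family `b`),
  **`rank_borderedHessian_eq_hessianRank_of_fderiv_eq_zero`** (`rank B_f(v)[b] = rk D²f(v)` for a basis),
  `fderiv_eq_zero_of_rank_borderedHessian_le_one` (`Σ₁ ⊆ Sing`), `rank_borderedHessian_le_one_iff`,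
  **`rank_borderedHessian_eq_zero_iff`** (`⟺ df(v) = 0 ∧ D²f(v) = 0`),
  `rank_borderedHessian_eq_zero_iff_three_le_pointOrder` (`Σ₀ = {ord ≥ 3}` on `f = 0`),
  `hessianRank_tangentSection_eq_zero_of_fderiv_fderiv_eq_zero`,
  **`rank_borderedHessian_eq_two_of_fderiv_fderiv_eq_zero`** (planar smooth point: `rank B = 2`),
  **`setOf_rank_borderedHessian_le_eq_union`** (`{f = 0, rank B ≤ r} = {f = 0, df ≠ 0, rk S + 2 ≤ r} ∪
  {f = 0, df = 0, rk D²f ≤ r}`), `setOf_rank_borderedHessian_le_one_eq`.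
* §3 (complex tori, `ϑ ∈ H⁰(L(H,χ)) ∖ 0`) **`rank_borderedHessian_eq_zero_iff_three_le_divisorMultAt`**
  (`Σ₀(D) = {mult_x(D) ≥ 3}`), `two_le_divisorMultAt_of_rank_borderedHessian_le_one` (`Σ₁(D) ⊆ Sing D`).
* §4 (Riemann theta functions, `Z ∈ 𝔥_g`, even `[k,l]`)
  **`rank_borderedHessian_riemannThetaChar_half_zero_eq`** (`rank B_{ϑ[k/2;l/2](·,Z)}(0)[e] = rk
  (∂ⱼ∂ᵢϑ[k/2;l/2](·,Z))(0)`: GSM 2007's bordered matrix at an even two-torsion point has the rank of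
  GSM 2008's Hessian), **`memThetaNullRankAt_iff_rank_borderedHessian_le`** (`Z ∈ θ_{[k,l]}^h ⟺
  ϑ[k/2;l/2](0,Z) = 0 ∧ rank B ≤ h`: `θ_null^h` is the Thom–Boardman locus `Σ_h` of the Gauss map of the
  universal theta divisor along the even two-torsion sections).

## What is NOT here

Dimension statements for the strata (`codim θ_null^h`, Ciliberto–van der Geer's bounds).

## References

* [GrushevskySalvatiManni2008] S. Grushevsky, R. Salvati Manni, Israel J. Math. 164 (2008), Def. 6
  (p0004 of the held text).
* [GrushevskySalvatiManni2007PointsOfOrderTwo] S. Grushevsky, R. Salvati Manni, IMRN 2007, Lemma 2 and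
  the proof of Thm. 3 (chunk p0007), p0010.
* [CilibertoVandergeer2008] C. Ciliberto, G. van der Geer, Doc. Math. 13 (2008), §2 (chunk p0005), Def. 9.
* [EisenbudHarris2016] D. Eisenbud, J. Harris, *3264 and All That* (2016), Thm. 7.11 (chunk p0291).
* [Lange2023AbelianVarietiesComplex] H. Lange, *Abelian Varieties over the Complex Numbers* (2023),
  §2.3.4 (p. 105).
-/

noncomputable section

open scoped Manifold Topology Matrix
open Set Function Module

namespace Literature.Geometry.Kaehler

universe u

namespace SCV

/-! ### §1 Linear algebra: a bordered matrix with vanishing border -/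

section LinearAlgebra

variable {ι' : Type*} [Fintype ι'] [DecidableEq ι']

omit [DecidableEq ι'] in
/-- `rank ( H 0 ; 0 0 ) = rank H` (block-diagonal rank, the corner block being `0`). [cite: GrushevskySalvatiManni2007PointsOfOrderTwo, Lemma 2 (chunk p0007)] -/
theorem rank_fromBlocks_border_zero (H : Matrix ι' ι' ℂ) :
    (Matrix.fromBlocks H (0 : Matrix ι' Unit ℂ) (0 : Matrix Unit ι' ℂ) (0 : Matrix Unit Unit ℂ)).rank =
      H.rank := by
  rw [Literature.LinearAlgebra.Matrix.rank_fromBlocks_zero₁₂_zero₂₁, Matrix.rank_zero, add_zero]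

end LinearAlgebra

/-! ### §2 SCV: the bordered Hessian at a singular point of `{f = 0}` -/

section Singular

variable {E : Type*} [NormedAddCommGroup E] [NormedSpace ℂ E] {ι' : Type*} [Fintype ι'] [DecidableEq ι']

omit [Fintype ι'] [DecidableEq ι'] in
/-- At a point with `df(v) = 0` the border of `B_f(v)[b]` vanishes: `B_f(v)[b] = ( H_f(v)[b] 0 ; 0 0 )`.
[cite: GrushevskySalvatiManni2007PointsOfOrderTwo, proof of Thm. 3 (chunk p0007: the matrix `( θ_{ij} θ_i ; θ_j 0 )`)] -/
theorem bordered_eq_fromBlocks_of_fderiv_eq_zero {f : E → ℂ} {v : E} (hd : fderiv ℂ f v = 0)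
    (b : ι' → E) :
    Matrix.fromBlocks (Matrix.of fun i j => fderiv ℂ (fderiv ℂ f) v (b i) (b j))
        (Matrix.of fun i (_ : Unit) => fderiv ℂ f v (b i))
        (Matrix.of fun (_ : Unit) j => fderiv ℂ f v (b j)) (0 : Matrix Unit Unit ℂ) =
      Matrix.fromBlocks (Matrix.of fun i j => fderiv ℂ (fderiv ℂ f) v (b i) (b j))
        (0 : Matrix ι' Unit ℂ) (0 : Matrix Unit ι' ℂ) (0 : Matrix Unit Unit ℂ) := by
  have h1 : (Matrix.of fun i (_ : Unit) => fderiv ℂ f v (b i)) = (0 : Matrix ι' Unit ℂ) := by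
    ext i u
    rw [Matrix.of_apply, hd, _root_.zero_apply, Matrix.zero_apply]
  have h2 : (Matrix.of fun (_ : Unit) j => fderiv ℂ f v (b j)) = (0 : Matrix Unit ι' ℂ) := by
    ext u j
    rw [Matrix.of_apply, hd, _root_.zero_apply, Matrix.zero_apply]
  rw [h1, h2]

omit [DecidableEq ι'] in
/-- **At a singular point the bordered rank is the Hessian rank**: `df(v) = 0 ⟹ rank B_f(v)[b] =
rank H_f(v)[b]` for any family `b`. [cite: GrushevskySalvatiManni2007PointsOfOrderTwo, proof of Thm. 3 (chunk p0007)] [cite: GrushevskySalvatiManni2008, Def. 6 (p0004 of the held text)] -/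
theorem rank_borderedHessian_eq_rank_hessian_of_fderiv_eq_zero {f : E → ℂ} {v : E}
    (hd : fderiv ℂ f v = 0) (b : ι' → E) :
    (Matrix.fromBlocks (Matrix.of fun i j => fderiv ℂ (fderiv ℂ f) v (b i) (b j))
        (Matrix.of fun i (_ : Unit) => fderiv ℂ f v (b i))
        (Matrix.of fun (_ : Unit) j => fderiv ℂ f v (b j)) (0 : Matrix Unit Unit ℂ)).rank =
      (Matrix.of fun i j => fderiv ℂ (fderiv ℂ f) v (b i) (b j)).rank := by
  rw [bordered_eq_fromBlocks_of_fderiv_eq_zero hd b, rank_fromBlocks_border_zero]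

variable [FiniteDimensional ℂ E]

/-- **`rank B_f(v)[b] = rk D²f(v) = rk TC_v` at a singular point** (`df(v) = 0`, `b` a basis): on `Sing D`
the Thom–Boardman rank is the rank of the tangent cone quadric (the corank stratification `S_{g,k}`).
[cite: CilibertoVandergeer2008, §2 (chunk p0005) and Def. 9] [cite: GrushevskySalvatiManni2008, Def. 6 (p0004 of the held text)] -/
theorem rank_borderedHessian_eq_hessianRank_of_fderiv_eq_zero (f : E → ℂ) (b : Basis ι' ℂ E) {v : E}
    (hd : fderiv ℂ f v = 0) :
    (Matrix.fromBlocks (Matrix.of fun i j => fderiv ℂ (fderiv ℂ f) v (b i) (b j))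
        (Matrix.of fun i (_ : Unit) => fderiv ℂ f v (b i))
        (Matrix.of fun (_ : Unit) j => fderiv ℂ f v (b j)) (0 : Matrix Unit Unit ℂ)).rank =
      hessianRank f v := by
  rw [rank_borderedHessian_eq_rank_hessian_of_fderiv_eq_zero hd b, hessianRank_def,
    finrank_range_eq_rank_of_basis' b]

/-- **`Σ₁(D) ⊆ Sing D`**: `rank B_f(v)[b] ≤ 1` forces `df(v) = 0` (on the smooth part the rank is `≥ 2`,
A2-207). [cite: GrushevskySalvatiManni2007PointsOfOrderTwo, Lemma 2 (chunk p0007)] [cite: EisenbudHarris2016, Thm. 7.11 (chunk p0291)] -/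
theorem fderiv_eq_zero_of_rank_borderedHessian_le_one {f : E → ℂ} (hf : Differentiable ℂ f)
    (b : Basis ι' ℂ E) {v : E}
    (h1 : (Matrix.fromBlocks (Matrix.of fun i j => fderiv ℂ (fderiv ℂ f) v (b i) (b j))
        (Matrix.of fun i (_ : Unit) => fderiv ℂ f v (b i))
        (Matrix.of fun (_ : Unit) j => fderiv ℂ f v (b j)) (0 : Matrix Unit Unit ℂ)).rank ≤ 1) :
    fderiv ℂ f v = 0 := by
  by_contra hd
  have h2 := two_le_rank_borderedHessian hf b hd
  omega

/-- `rank B_f(v)[b] ≤ 1 ⟺ df(v) = 0 ∧ rk D²f(v) ≤ 1` (the tangent cone is a double hyperplane or zero).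
[cite: CilibertoVandergeer2008, §2 (chunk p0005)] [cite: GrushevskySalvatiManni2007PointsOfOrderTwo, Lemma 2 (chunk p0007)] -/
theorem rank_borderedHessian_le_one_iff {f : E → ℂ} (hf : Differentiable ℂ f) (b : Basis ι' ℂ E) {v : E} :
    (Matrix.fromBlocks (Matrix.of fun i j => fderiv ℂ (fderiv ℂ f) v (b i) (b j))
        (Matrix.of fun i (_ : Unit) => fderiv ℂ f v (b i))
        (Matrix.of fun (_ : Unit) j => fderiv ℂ f v (b j)) (0 : Matrix Unit Unit ℂ)).rank ≤ 1 ↔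
      fderiv ℂ f v = 0 ∧ hessianRank f v ≤ 1 := by
  constructor
  · intro h1
    have hd := fderiv_eq_zero_of_rank_borderedHessian_le_one hf b h1
    rw [rank_borderedHessian_eq_hessianRank_of_fderiv_eq_zero f b hd] at h1
    exact ⟨hd, h1⟩
  · rintro ⟨hd, h1⟩
    rwa [rank_borderedHessian_eq_hessianRank_of_fderiv_eq_zero f b hd]

/-- **`rank B_f(v)[b] = 0 ⟺ df(v) = 0 ∧ D²f(v) = 0`**. [cite: CilibertoVandergeer2008, §2 (chunk p0005: corank `g`)] [cite: GrushevskySalvatiManni2007PointsOfOrderTwo, Lemma 2 (chunk p0007)] -/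
theorem rank_borderedHessian_eq_zero_iff {f : E → ℂ} (hf : Differentiable ℂ f) (b : Basis ι' ℂ E) {v : E} :
    (Matrix.fromBlocks (Matrix.of fun i j => fderiv ℂ (fderiv ℂ f) v (b i) (b j))
        (Matrix.of fun i (_ : Unit) => fderiv ℂ f v (b i))
        (Matrix.of fun (_ : Unit) j => fderiv ℂ f v (b j)) (0 : Matrix Unit Unit ℂ)).rank = 0 ↔
      fderiv ℂ f v = 0 ∧ fderiv ℂ (fderiv ℂ f) v = 0 := by
  rw [← hessianRank_eq_zero_iff]
  constructor
  · intro h0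
    have hd := fderiv_eq_zero_of_rank_borderedHessian_le_one hf b (v := v) (by omega)
    rw [rank_borderedHessian_eq_hessianRank_of_fderiv_eq_zero f b hd] at h0
    exact ⟨hd, h0⟩
  · rintro ⟨hd, h0⟩
    rwa [rank_borderedHessian_eq_hessianRank_of_fderiv_eq_zero f b hd]

/-- **`Σ₀ = {mult ≥ 3}`**: on `f(v) = 0`, `rank B_f(v)[b] = 0 ⟺ ord_v f ≥ 3`. [cite: Lange2023AbelianVarietiesComplex, §2.3.4 (p. 105 L20)] [cite: CilibertoVandergeer2008, §2 (chunk p0005)] -/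
theorem rank_borderedHessian_eq_zero_iff_three_le_pointOrder {f : E → ℂ} (hf : Differentiable ℂ f)
    (b : Basis ι' ℂ E) {v : E} (hv : f v = 0) :
    (Matrix.fromBlocks (Matrix.of fun i j => fderiv ℂ (fderiv ℂ f) v (b i) (b j))
        (Matrix.of fun i (_ : Unit) => fderiv ℂ f v (b i))
        (Matrix.of fun (_ : Unit) j => fderiv ℂ f v (b j)) (0 : Matrix Unit Unit ℂ)).rank = 0 ↔
      (3 : ℕ∞) ≤ pointOrder f v := by
  rw [rank_borderedHessian_eq_zero_iff hf b]
  constructor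
  · rintro ⟨hd, h0⟩
    have h2 : (2 : ℕ∞) ≤ pointOrder f v := (two_le_pointOrder_iff hf).2 ⟨hv, hd⟩
    exact (hessianRank_eq_zero_iff_three_le_pointOrder hf h2).1 ((hessianRank_eq_zero_iff f v).2 h0)
  · intro h3
    have h2 : (2 : ℕ∞) ≤ pointOrder f v := le_trans (by norm_num) h3
    exact ⟨((two_le_pointOrder_iff hf).1 h2).2,
      (hessianRank_eq_zero_iff f v).1 (hessianRank_eq_zero_of_three_le_pointOrder hf h3)⟩

/-- If `D²f(v) = 0` then the tangent hyperplane section `f_T` has `rk D²f_T(0) = 0` (`S_x = 0`).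
[cite: GrushevskySalvatiManni2007PointsOfOrderTwo, p0010 ("`0 = θ(τ,z) = ∂ᵢ∂ⱼθ(τ,z)` automatically" at odd points)] -/
theorem hessianRank_tangentSection_eq_zero_of_fderiv_fderiv_eq_zero {f : E → ℂ} (hf : Differentiable ℂ f)
    {v : E} (hH : fderiv ℂ (fderiv ℂ f) v = 0) :
    hessianRank (fun w : LinearMap.ker (fderiv ℂ f v : E →ₗ[ℂ] ℂ) => f (v + (w : E))) 0 = 0 := by
  rw [hessianRank_eq_zero_iff]
  ext w w'
  rw [fderiv_fderiv_tangentSection hf v w w', hH]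
  rfl

/-- **A PLANAR SMOOTH POINT HAS `rank B = 2` EXACTLY**: `df(v) ≠ 0`, `D²f(v) = 0` ⟹ `rank B_f(v)[b] = 2`
(`= rk S_x + 2` with `S_x = 0`; e.g. the smooth odd two-torsion points of a symmetric theta divisor,
A2-202, lie in `Σ₂ ∖ Σ₁`). [cite: GrushevskySalvatiManni2007PointsOfOrderTwo, Lemma 2 (chunk p0007) and p0010] [cite: EisenbudHarris2016, Thm. 7.11 (chunk p0291)] -/
theorem rank_borderedHessian_eq_two_of_fderiv_fderiv_eq_zero {f : E → ℂ} (hf : Differentiable ℂ f)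
    (b : Basis ι' ℂ E) {v : E} (hd : fderiv ℂ f v ≠ 0) (hH : fderiv ℂ (fderiv ℂ f) v = 0) :
    (Matrix.fromBlocks (Matrix.of fun i j => fderiv ℂ (fderiv ℂ f) v (b i) (b j))
        (Matrix.of fun i (_ : Unit) => fderiv ℂ f v (b i))
        (Matrix.of fun (_ : Unit) j => fderiv ℂ f v (b j)) (0 : Matrix Unit Unit ℂ)).rank = 2 := by
  rw [rank_borderedHessian_eq hf b hd, hessianRank_tangentSection_eq_zero_of_fderiv_fderiv_eq_zero hf hH]

/-- **`Σ_r = (smooth stratum) ⊔ (singular stratum)`**: `{f = 0, rank B_f ≤ r} = {f = 0, df ≠ 0,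
rk S_x + 2 ≤ r} ∪ {f = 0, df = 0, rk D²f ≤ r}` — on `D_s` the Thom–Boardman condition is on the second
fundamental form (A2-207), on `Sing D` on the tangent cone. [cite: EisenbudHarris2016, Thm. 7.11 (chunk p0291)] [cite: CilibertoVandergeer2008, §2 (chunk p0005) and Def. 9] -/
theorem setOf_rank_borderedHessian_le_eq_union {f : E → ℂ} (hf : Differentiable ℂ f) (b : Basis ι' ℂ E)
    (r : ℕ) :
    {v | f v = 0 ∧
      (Matrix.fromBlocks (Matrix.of fun i j => fderiv ℂ (fderiv ℂ f) v (b i) (b j))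
        (Matrix.of fun i (_ : Unit) => fderiv ℂ f v (b i))
        (Matrix.of fun (_ : Unit) j => fderiv ℂ f v (b j)) (0 : Matrix Unit Unit ℂ)).rank ≤ r} =
      {v | f v = 0 ∧ fderiv ℂ f v ≠ 0 ∧
        hessianRank (fun w : LinearMap.ker (fderiv ℂ f v : E →ₗ[ℂ] ℂ) => f (v + (w : E))) 0 + 2 ≤ r} ∪
      {v | f v = 0 ∧ fderiv ℂ f v = 0 ∧ hessianRank f v ≤ r} := by
  ext v
  simp only [mem_setOf_eq, mem_union]
  by_cases hd : fderiv ℂ f v = 0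
  · rw [rank_borderedHessian_eq_hessianRank_of_fderiv_eq_zero f b hd]
    exact ⟨fun ⟨hv, hr⟩ => Or.inr ⟨hv, hd, hr⟩,
      fun h' => h'.elim (fun ⟨_, hd', _⟩ => (hd' hd).elim) fun ⟨hv, _, hr⟩ => ⟨hv, hr⟩⟩
  · rw [rank_borderedHessian_eq hf b hd]
    exact ⟨fun ⟨hv, hr⟩ => Or.inl ⟨hv, hd, hr⟩,
      fun h' => h'.elim (fun ⟨hv, _, hr⟩ => ⟨hv, hr⟩) fun ⟨_, hd', _⟩ => (hd hd').elim⟩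

/-- **`Σ₁ ⊆ Sing`**: `{f = 0, rank B_f ≤ 1} = {f = 0, df = 0, rk D²f ≤ 1}`. [cite: CilibertoVandergeer2008, §2 (chunk p0005)] [cite: GrushevskySalvatiManni2007PointsOfOrderTwo, Lemma 2 (chunk p0007)] -/
theorem setOf_rank_borderedHessian_le_one_eq {f : E → ℂ} (hf : Differentiable ℂ f) (b : Basis ι' ℂ E) :
    {v | f v = 0 ∧
      (Matrix.fromBlocks (Matrix.of fun i j => fderiv ℂ (fderiv ℂ f) v (b i) (b j))
        (Matrix.of fun i (_ : Unit) => fderiv ℂ f v (b i))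
        (Matrix.of fun (_ : Unit) j => fderiv ℂ f v (b j)) (0 : Matrix Unit Unit ℂ)).rank ≤ 1} =
      {v | f v = 0 ∧ fderiv ℂ f v = 0 ∧ hessianRank f v ≤ 1} := by
  ext v
  simp only [mem_setOf_eq, rank_borderedHessian_le_one_iff hf b]

end Singular

end SCV

/-! ### §3 Complex tori: `Σ₀(D) = {mult_x(D) ≥ 3}` and `Σ₁(D) ⊆ Sing D` -/

namespace ComplexTorus

section Divisor

variable {ι : Type*} [Fintype ι] {E : Type u} [NormedAddCommGroup E] [InnerProductSpace ℂ E]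
  [FiniteDimensional ℂ E] {Φ : (ι → ℝ) ≃L[ℝ] E} {d : ℕ} {n : ℕ} (e : Fin n ≃ ι) (h : 2 * d + 2 = n)
  {η : E [⋀^Fin 2]→L[ℝ] ℝ} {χ : (ι → ℤ) → ℂ} {ι' : Type*} [Fintype ι'] [DecidableEq ι']

include e h in
/-- **`Σ₀(D) = {x : mult_x(D) ≥ 3}`** for `D = (ϑ)`, `ϑ ∈ H⁰(L(H,χ)) ∖ 0`: at a point of `D`,
`rank B_ϑ(v)[b] = 0 ⟺ mult_{π(v)}(D) ≥ 3`. [cite: Lange2023AbelianVarietiesComplex, §2.3.4 (p. 105 L20)] [cite: CilibertoVandergeer2008, §2 (chunk p0005)] -/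
theorem rank_borderedHessian_eq_zero_iff_three_le_divisorMultAt (hη : IsNSForm Φ η)
    (hχ : IsSemicharacter Φ η χ) {ϑ : E → ℂ} (hϑ : ϑ ∈ thetaFunctions Φ (canonicalFactor Φ η χ))
    (hϑ0 : ϑ ≠ 0) (b : Basis ι' ℂ E) {v : E} (hv : ϑ v = 0) :
    (Matrix.fromBlocks (Matrix.of fun i j => fderiv ℂ (fderiv ℂ ϑ) v (b i) (b j))
        (Matrix.of fun i (_ : Unit) => fderiv ℂ ϑ v (b i))
        (Matrix.of fun (_ : Unit) j => fderiv ℂ ϑ v (b j)) (0 : Matrix Unit Unit ℂ)).rank = 0 ↔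
      3 ≤ divisorMultAt Φ d (divisorChain Φ d ϑ) (cover Φ v) := by
  rw [SCV.rank_borderedHessian_eq_zero_iff_three_le_pointOrder (mem_thetaFunctions_iff.1 hϑ).1 b hv,
    divisorMultAt_divisorChain_cover e h hη hχ hϑ hϑ0]

include e h in
/-- **`Σ₁(D) ⊆ Sing D`**: `rank B_ϑ(v)[b] ≤ 1` at a point of `D = (ϑ)` forces `mult_{π(v)}(D) ≥ 2`.
[cite: GrushevskySalvatiManni2007PointsOfOrderTwo, Lemma 2 (chunk p0007)] [cite: Lange2023AbelianVarietiesComplex, §2.3.4 (p. 105 L20)] -/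
theorem two_le_divisorMultAt_of_rank_borderedHessian_le_one (hη : IsNSForm Φ η)
    (hχ : IsSemicharacter Φ η χ) {ϑ : E → ℂ} (hϑ : ϑ ∈ thetaFunctions Φ (canonicalFactor Φ η χ))
    (hϑ0 : ϑ ≠ 0) (b : Basis ι' ℂ E) {v : E} (hv : ϑ v = 0)
    (h1 : (Matrix.fromBlocks (Matrix.of fun i j => fderiv ℂ (fderiv ℂ ϑ) v (b i) (b j))
        (Matrix.of fun i (_ : Unit) => fderiv ℂ ϑ v (b i))
        (Matrix.of fun (_ : Unit) j => fderiv ℂ ϑ v (b j)) (0 : Matrix Unit Unit ℂ)).rank ≤ 1) :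
    2 ≤ divisorMultAt Φ d (divisorChain Φ d ϑ) (cover Φ v) := by
  have hϑd := (mem_thetaFunctions_iff.1 hϑ).1
  have hd := SCV.fderiv_eq_zero_of_rank_borderedHessian_le_one hϑd b h1
  have h2 : (2 : ℕ∞) ≤ SCV.pointOrder ϑ v := (SCV.two_le_pointOrder_iff hϑd).2 ⟨hv, hd⟩
  rw [divisorMultAt_divisorChain_cover e h hη hχ hϑ hϑ0]
  exact_mod_cast h2

end Divisor

/-! ### §4 Riemann theta functions: `θ_{[k,l]}^h` is `Σ_h` at the even two-torsion point -/

section ThetaNull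

open Complex
open Literature.Analysis.SpecialFunctions Literature.Analysis.Complex
open Literature.NumberTheory.Automorphic (siegelUpperHalfSpace)

variable {n : ℕ} {Z : Matrix (Fin n) (Fin n) ℂ}

/-- **GSM 2007's bordered matrix at an even two-torsion point has the rank of GSM 2008's Hessian**: for
`Z ∈ 𝔥_g` and `k, l ∈ ℤ^g` with `ᵗkl` even (so that `ϑ[k/2;l/2](·,Z)` is even and its gradient at `0`
vanishes), `rank ( D²ϑ(0)(eᵢ,eⱼ) dϑ(0)eᵢ ; dϑ(0)eⱼ 0 ) = rk (∂ⱼ∂ᵢϑ)(0)`, `ϑ = ϑ[k/2;l/2](·,Z)`.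
[cite: GrushevskySalvatiManni2007PointsOfOrderTwo, proof of Thm. 3 (chunk p0007: "`rk ( θ_{ij} θ_i ; θ_j 0 ) ≤ h`")] [cite: GrushevskySalvatiManni2008, Def. 6 (p0004 of the held text)] -/
theorem rank_borderedHessian_riemannThetaChar_half_zero_eq (hZ : Z ∈ siegelUpperHalfSpace n)
    (k l : Fin n → ℤ) (heven : Even (k ⬝ᵥ l)) :
    (Matrix.fromBlocks
        (Matrix.of fun i j : Fin n => fderiv ℂ (fderiv ℂ
          (riemannThetaChar (fun i => (k i : ℂ) / 2) (fun i => (l i : ℂ) / 2) Z)) 0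
          (Pi.single i (1 : ℂ)) (Pi.single j (1 : ℂ)))
        (Matrix.of fun (i : Fin n) (_ : Unit) => fderiv ℂ
          (riemannThetaChar (fun i => (k i : ℂ) / 2) (fun i => (l i : ℂ) / 2) Z) 0 (Pi.single i (1 : ℂ)))
        (Matrix.of fun (_ : Unit) (j : Fin n) => fderiv ℂ
          (riemannThetaChar (fun i => (k i : ℂ) / 2) (fun i => (l i : ℂ) / 2) Z) 0 (Pi.single j (1 : ℂ)))
        (0 : Matrix Unit Unit ℂ)).rank =
      (Matrix.of fun i j : Fin n => fderiv ℂ (fun z => fderiv ℂ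
          (riemannThetaChar (fun i => (k i : ℂ) / 2) (fun i => (l i : ℂ) / 2) Z) z (Pi.single i (1 : ℂ))) 0
          (Pi.single j (1 : ℂ))).rank := by
  obtain ⟨c, hc, hY⟩ := exists_pos_mul_sum_sq_le_of_posDef_im Z hZ.2
  have hZs : ∀ i j, Z i j = Z j i := fun i j => (hZ.1.apply i j).symm
  have hGd : Differentiable ℂ (riemannThetaChar (fun i => (k i : ℂ) / 2) (fun i => (l i : ℂ) / 2) Z) :=
    differentiable_riemannThetaChar Z hZs hc hY _ _
  have hd : fderiv ℂ (riemannThetaChar (fun i => (k i : ℂ) / 2) (fun i => (l i : ℂ) / 2) Z) 0 = 0 :=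
    fderiv_riemannThetaChar_half_zero_of_even Z hZs hc hY k l heven
  rw [SCV.rank_borderedHessian_eq_rank_hessian_of_fderiv_eq_zero hd]
  -- the two Hessian-matrix conventions agree (symmetry of `D²ϑ`)
  congr 1
  ext i j
  rw [Matrix.of_apply, Matrix.of_apply, fderiv_fderiv_apply_eq_of_differentiable hGd,
    SCV.fderiv_fderiv_symm hGd]

/-- **`θ_{[k,l]}^h = Σ_h` AT THE EVEN TWO-TORSION SECTION**: for `Z ∈ 𝔥_g` and even `[k,l]`,
`Z ∈ θ_{[k,l]}^h` (GSM 2008 Def. 6: `ϑ[k/2;l/2](0,Z) = 0` and `rk (∂ᵢ∂ⱼϑ)(0) ≤ h`) iff `ϑ[k/2;l/2](0,Z) = 0`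
and the bordered Hessian of `ϑ[k/2;l/2](·,Z)` at `0` has rank `≤ h` — the Thom–Boardman condition of the
Gauss map (A2-207) at the two-torsion point `[k/2;l/2]` of `Θ`. [cite: GrushevskySalvatiManni2008, Def. 6 (p0004 of the held text)] [cite: GrushevskySalvatiManni2007PointsOfOrderTwo, proof of Thm. 3 (chunk p0007)] -/
theorem memThetaNullRankAt_iff_rank_borderedHessian_le (hZ : Z ∈ siegelUpperHalfSpace n)
    (k l : Fin n → ℤ) (heven : Even (k ⬝ᵥ l)) (h : ℕ) :
    MemThetaNullRankAt k l h Z ↔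
      riemannThetaChar (fun i => (k i : ℂ) / 2) (fun i => (l i : ℂ) / 2) Z 0 = 0 ∧
        (Matrix.fromBlocks
          (Matrix.of fun i j : Fin n => fderiv ℂ (fderiv ℂ
            (riemannThetaChar (fun i => (k i : ℂ) / 2) (fun i => (l i : ℂ) / 2) Z)) 0
            (Pi.single i (1 : ℂ)) (Pi.single j (1 : ℂ)))
          (Matrix.of fun (i : Fin n) (_ : Unit) => fderiv ℂ
            (riemannThetaChar (fun i => (k i : ℂ) / 2) (fun i => (l i : ℂ) / 2) Z) 0 (Pi.single i (1 : ℂ)))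
          (Matrix.of fun (_ : Unit) (j : Fin n) => fderiv ℂ
            (riemannThetaChar (fun i => (k i : ℂ) / 2) (fun i => (l i : ℂ) / 2) Z) 0 (Pi.single j (1 : ℂ)))
          (0 : Matrix Unit Unit ℂ)).rank ≤ h := by
  rw [memThetaNullRankAt_iff, rank_borderedHessian_riemannThetaChar_half_zero_eq hZ k l heven]

end ThetaNull

end ComplexTorus

end Literature.Geometry.Kaehler
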